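import Summits.QuantumFields.YangMills.Theorems.LocalInsertionCombGaugeBox
import Summits.QuantumFields.YangMills.Theorems.LocalInsertionHistoryTailOfInsertionLPerPlaquette
import HarnessLib

/-!
# Line «local_insertion» on crux `HistoryTailL` (stmt-QuantumFields-19936) — THE HEIGHT-ONE MEDIAN ROW FROM THE MEAN PLAQUETTE
# DEVIATION AT THE GAUSSIAN SCALE («MEDIAN-1 ⇐ EQUIPARTITION», kernel face)

Cell `ym3-torus` (YM ladder rung R3 = continuum SU(2) Yang–Mills on the three-torus — a RUNG, NOT the Clay problem: not d = 4, not
infinite volume, not a mass gap), width seat `ym-ust-19936-w3` gen 11, `--supports stmt-QuantumFields-19936 --as helper`.  THEOREMS ONLY,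
definition-free, ROUTE-INDEPENDENT (no `Theses` import).  HONEST FRAMING: a CONDITIONAL step at one instance `(F, γ, K ≥ 3, a)`.  Its
hypotheses — the window-Lipschitz row `hK2` at height one (the TEXT of ✓`PoincareLipschitzLevelOneLipschitz.stub_levelOneLipschitz`, a theorem),
the FIRST MOMENT OF THE BARE PLAQUETTE DEVIATION AT SCALE `g_K`, `hE1 : ∫ dist1 U(∂p) ∂Gibbs_K ≤ C₁·√(γL^{−K})` for every level-0 plaquette
(uniform in `K` and `γ` — an equipartition-type upper bound; the tree holds it only with a `√(log β)` loss:
✓`WilsonPlaquetteWeakCouplingFloor.wilsonExpectation_wilsonAction_le_linkBall`), and local goodness `Gibbs_K(G(a,1)ᶜ) ≤ ¼` — are NOT all in the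
tree.  Nothing of `LocalInsertionL` (23607), `MesoscopicConcentrationL` (23532), the stubs of `Cruxes/HistoryTailL/Lines/local_insertion.lean`,
the crux `HistoryTailL` or any summit statement is proved.

WHAT.  ★★`median_heightOne_of_meanPlaquette`: under `hK2 ∧ hE1 ∧ hGc`, the MEDIAN ROW of ✓`WindowTailOfConcentration.windowTail_step` at
`(a, j = 1)`: `½ ≤ Gibbs_K(G(a,1) ∩ {dist1(Ū¹(∂a)) ≤ m·g_{K−1}})` with the `K`- and `γ`-UNIFORM level `m = 36(CL+1)(C₁+1)(17L)⁴/L`.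
HOW.  On the window, `dist1(Ū¹(∂a))(U) = dist1(Ū¹(∂a))(U^g)` (gauge invariance) `≤ (CL/√L)·d_box(U^g, 1)` (`hK2` against the trivial
configuration, `Ū¹(1) = 1`) for the COMB gauge `g = g_U` of the `17L`-box (✓`CombGauge.exists_combGauge_dist1_le`): `d_box ≤ Σ_{box bonds} dist1((U^g)_b)`
(`ℓ² ≤ ℓ¹`) and each gauged link is bounded by configuration-independent ladder sums of `dist1 U(∂p)`; integrating, `E[dist1(Ū¹(∂a))·1_G] ≤
(CL/√L)·3(17L)³·3·17L·C₁·g_K` (`≤ 3n³` box bonds, `3n` plaquettes each), `g_K = g_{K−1}/√L`; Markov on `G` and `Gibbs_K(G) ≥ ¾`.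
SO: the height-one median row of engine (E3) — and with ✓`InsertionStepOfConcentration.insertion_step` the height-one insertion bound, given K1 —
reduces to the mean plaquette deviation AT THE GAUSSIAN SCALE, uniformly in the cut-off and the coupling.
[cite: Balaban1985UV3, (3) p.256 and (7) p.257; Balaban1985Averaging, (8)-(9) p.19]
-/

set_option autoImplicit false

noncomputable section

open scoped BigOperators
open MeasureTheory
open Literature.MathematicalPhysics.QuantumFieldTheory.Balaban1983to89
open Literature.MathematicalPhysics.QuantumFieldTheory.Balaban1983to89.T3ContinuumYM3Torus
open Literature.MathematicalPhysics.QuantumFieldTheory.Balaban1983to89.T3UnitScaleTilt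
open Literature.MathematicalPhysics.QuantumFieldTheory.Balaban1983to89.T3UnitLawDensityEML
open Literature.MathematicalPhysics.QuantumFieldTheory.Balaban1983to89.T3MinimiserStabilityReduction (θBal_pos)
open Summit.QuantumFields.YangMills.Theorems.PoincareLipschitz.TwoSidedOfConcentration (dist1_plaqHol_iter_gaugeAct)

namespace Summit.QuantumFields.YangMills.Theorems.LocalInsertion.MedianHeightOne

/-- **THE RESTRICTED MEAN OF THE HEIGHT-ONE BLOCK FLUX FROM THE MEAN PLAQUETTE DEVIATION** (the analytic half of
`median_heightOne_of_meanPlaquette`): under `hK2` (window-Lipschitz at height one) and `hE1` (`∫ dist1 U(∂p) ≤ C₁·g_K` for every level-0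
plaquette), `∫ 1_{G(a,1)}·dist1(Ū¹(∂a)) ∂Gibbs_K ≤ (CL/√L)·(3·(17L)³)·(17L·3·C₁·g_K)` — comb gauge + ladders + `ℓ² ≤ ℓ¹` + linearity.
[cite: Balaban1985UV3, (3) p.256 and (7) p.257; Balaban1985Averaging, (8)-(9) p.19] -/
theorem integral_indicator_heightOne_le (F : T3Family) {γ b₀ p₀ CL C₁ : ℝ} (hγ : 0 < γ) (hγ1 : γ ≤ 1) (hb₀ : 0 < b₀)
    {K : ℕ} (hK : 3 ≤ K) (a : Plaq (F.P K) 1) (hCL : 0 ≤ CL) (hC₁ : 0 ≤ C₁)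
    (hK2 : ∀ U U' : GaugeField (F.P K) 0 (Matrix.specialUnitaryGroup (Fin 2) ℂ), (∀ (i : ℕ) (q : Plaq (F.P K) i), i < 1 → Site.tdist (fun k => ((((q.src k).val * F.L ^ i : ℕ)) : ZMod ((F.P K).sitesPerDir 0))) (fun k => ((((a.src k).val * F.L ^ 1 : ℕ)) : ZMod ((F.P K).sitesPerDir 0))) + 64 * F.L ^ i ≤ 64 * F.L ^ 1 → GaugeGroup.dist1 (GaugeField.plaqHol (Averaging.iter (fun i' => BlockAveraging.blockAvg (P := F.P K) (j := i') ℰp) i U) q) < θBal F.L γ b₀ p₀ (K - i)) → (∀ (i : ℕ) (q : Plaq (F.P K) i), i < 1 → Site.tdist (fun k => ((((q.src k).val * F.L ^ i : ℕ)) : ZMod ((F.P K).sitesPerDir 0))) (fun k => ((((a.src k).val * F.L ^ 1 : ℕ)) : ZMod ((F.P K).sitesPerDir 0))) + 64 * F.L ^ i ≤ 64 * F.L ^ 1 → GaugeGroup.dist1 (GaugeField.plaqHol (Averaging.iter (fun i' => BlockAveraging.blockAvg (P := F.P K) (j := i') ℰp) i U') q) < θBal F.L γ b₀ p₀ (K -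 i)) →
      |GaugeGroup.dist1 (GaugeField.plaqHol (Averaging.iter (fun i' => BlockAveraging.blockAvg (P := F.P K) (j := i') ℰp) 1 U) a) - GaugeGroup.dist1 (GaugeField.plaqHol (Averaging.iter (fun i' => BlockAveraging.blockAvg (P := F.P K) (j := i') ℰp) 1 U') a)| ≤ CL / Real.sqrt ((F.L : ℝ) ^ 1) * Real.sqrt (∑ b : PBond (F.P K) 0, if (∀ k, (b.src k - ((((a.src k).val * F.L ^ 1 : ℕ)) : ZMod ((F.P K).sitesPerDir 0)) + ((8 * F.L ^ 1 : ℕ) : ZMod ((F.P K).sitesPerDir 0))).val < 17 * F.L ^ 1) ∧ (∀ k, (b.tgt k - ((((a.src k).val * F.L ^ 1 : ℕ)) : ZMod ((F.P K).sitesPerDir 0)) + ((8 * F.L ^ 1 : ℕ) : ZMod ((F.P K).sitesPerDir 0))).val < 17 * F.L ^ 1) then GaugeGroup.dist1 (U b * (U' b)⁻¹) ^ 2 else 0))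
    (hE1 : ∀ p : Plaq (F.P K) 0, ∫ U, GaugeGroup.dist1 (GaugeField.plaqHol U p) ∂(gibbsK F ℰp γ K) ≤ C₁ * Real.sqrt (γ * ((F.L : ℝ)⁻¹) ^ K)) :
    ∫ U, Set.indicator {U : GaugeField (F.P K) 0 (Matrix.specialUnitaryGroup (Fin 2) ℂ) | (∀ (i : ℕ) (q : Plaq (F.P K) i), i < 1 → Site.tdist (fun k => ((((q.src k).val * F.L ^ i : ℕ)) : ZMod ((F.P K).sitesPerDir 0))) (fun k => ((((a.src k).val * F.L ^ 1 : ℕ)) : ZMod ((F.P K).sitesPerDir 0))) + 64 * F.L ^ i ≤ 64 * F.L ^ 1 → GaugeGroup.dist1 (GaugeField.plaqHol (Averaging.iter (fun i' => BlockAveraging.blockAvg (P := F.P K) (j := i') ℰp) i U) q) < θBal F.L γ b₀ p₀ (K - i))}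
      (fun U => GaugeGroup.dist1 (GaugeField.plaqHol (Averaging.iter (fun i' => BlockAveraging.blockAvg (P := F.P K) (j := i') ℰp) 1 U) a)) U ∂(gibbsK F ℰp γ K) ≤
      CL / Real.sqrt ((F.L : ℝ) ^ 1) * ((3 * ((17 * F.L ^ 1 : ℕ) : ℝ) ^ 3) * (((17 * F.L ^ 1 : ℕ) : ℝ) * (3 * (C₁ * Real.sqrt (γ * ((F.L : ℝ)⁻¹) ^ K))))) := by
  classical
  haveI := isProbabilityMeasure_gibbsK F ℰp hγ.le K
  haveI : NeZero ((F.P K).sitesPerDir 0) := ⟨by unfold Params.sitesPerDir; have := (F.P K).hL.2; positivity⟩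
  have hL1 : 1 ≤ F.L := F.hL.2.le
  have hL0 : (0 : ℝ) < F.L := by exact_mod_cast lt_of_lt_of_le zero_lt_one hL1
  have hLr1 : (1 : ℝ) ≤ F.L := by exact_mod_cast hL1
  set μ := gibbsK F ℰp γ K with hμ
  have hp1 : ∀ {i : ℕ} (p : Plaq (F.P K) i), GaugeField.plaqHol (1 : GaugeField (F.P K) i (Matrix.specialUnitaryGroup (Fin 2) ℂ)) p = 1 :=
    fun {i} p => by
      have h : ∀ b : PBond (F.P K) i, (1 : GaugeField (F.P K) i (Matrix.specialUnitaryGroup (Fin 2) ℂ)) b = 1 := fun b => rfl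
      simp [GaugeField.plaqHol, h]
  -- scales
  set gK : ℝ := Real.sqrt (γ * ((F.L : ℝ)⁻¹) ^ K) with hgK
  set g1 : ℝ := Real.sqrt (γ * ((F.L : ℝ)⁻¹) ^ (K - 1)) with hg1
  have hgKpos : 0 < gK := Real.sqrt_pos.2 (mul_pos hγ (pow_pos (inv_pos.2 hL0) _))
  have hg1pos : 0 < g1 := Real.sqrt_pos.2 (mul_pos hγ (pow_pos (inv_pos.2 hL0) _))
  have hgK1 : gK = g1 / Real.sqrt (F.L : ℝ) := by
    rw [hgK, hg1, eq_div_iff (Real.sqrt_pos.2 hL0).ne', ← Real.sqrt_mul (by positivity)]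
    congr 1
    have hK1 : K = (K - 1) + 1 := by omega
    conv_lhs => rw [hK1]
    rw [pow_succ]; field_simp
  -- the box, its base point and side
  set n : ℕ := 17 * F.L ^ 1 with hn
  set base : Site (F.P K) 0 := fun k => ((((a.src k).val * F.L ^ 1 : ℕ)) : ZMod ((F.P K).sitesPerDir 0)) - ((8 * F.L ^ 1 : ℕ) : ZMod ((F.P K).sitesPerDir 0)) with hbase
  have hbk : ∀ (y : Site (F.P K) 0) (k : Fin (F.P K).d), y k - ((((a.src k).val * F.L ^ 1 : ℕ)) : ZMod ((F.P K).sitesPerDir 0)) + ((8 * F.L ^ 1 : ℕ) : ZMod ((F.P K).sitesPerDir 0)) = y k - base k := by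
    intro y k; simp only [hbase]; ring
  have hnN : n + 1 ≤ (F.P K).sitesPerDir 0 := by rw [hn, pow_one]; exact box_fits F hK
  -- the three directions
  set e0 : Fin (F.P K).d := ⟨0, by show 0 < 3; norm_num⟩ with he0
  set e1 : Fin (F.P K).d := ⟨1, by show 1 < 3; norm_num⟩ with he1
  set e2 : Fin (F.P K).d := ⟨2, by show 2 < 3; norm_num⟩ with he2
  have h01 : e0 < e1 := by rw [he0, he1, Fin.lt_def]; norm_num
  have h02 : e0 < e2 := by rw [he0, he2, Fin.lt_def]; norm_num
  have h12 : e1 < e2 := by rw [he1, he2, Fin.lt_def]; norm_num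
  have hfull : ∀ k : Fin (F.P K).d, k = e0 ∨ k = e1 ∨ k = e2 := dir_cases F K
  -- the comb gauge, one per configuration
  have hcomb := fun U : GaugeField (F.P K) 0 (Matrix.specialUnitaryGroup (Fin 2) ℂ) =>
    Summit.QuantumFields.YangMills.Theorems.LocalInsertion.CombGauge.exists_combGauge_dist1_le U base h01 h02 h12 hfull n hnN
  choose gsel hgsel using hcomb
  -- the ladder sums of a bond (a configuration-independent plaquette family)
  set R : PBond (F.P K) 0 → GaugeField (F.P K) 0 (Matrix.specialUnitaryGroup (Fin 2) ℂ) → ℝ := fun b U =>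
    ∑ t ∈ Finset.range (17 * F.L ^ 1), (GaugeGroup.dist1 (GaugeField.plaqHol U ⟨Function.update (Function.update (Function.update base e0 (base e0 + (((b.src e0 - base e0).val : ℕ) : ZMod ((F.P K).sitesPerDir 0)))) e1 ((Function.update base e0 (base e0 + (((b.src e0 - base e0).val : ℕ) : ZMod ((F.P K).sitesPerDir 0)))) e1 + (((b.src e1 - base e1).val : ℕ) : ZMod ((F.P K).sitesPerDir 0)))) e2 ((Function.update (Function.update base e0 (base e0 + (((b.src e0 - base e0).val : ℕ) : ZMod ((F.P K).sitesPerDir 0)))) e1 ((Function.update base e0 (base e0 + (((b.src e0 - base e0).val : ℕ) : ZMod ((F.P K).sitesPerDir 0)))) e1 + (((b.src e1 - base e1).val : ℕ) : ZMod ((F.P K).sitesPerDir 0)))) e2 + (t : ZMod ((F.P K).sitesPerDir 0))), e0, e2, h02⟩) + GaugeGroup.dist1 (GaugeField.plaqHol U ⟨Function.update (Function.update base e0 (base e0 + (((b.src e0 - base e0).val : ℕ) : ZMod ((F.P K).sitesPerDir 0)))) e1 ((Function.update base e0 (base e0 + (((b.src e0 - base e0).val : ℕ) : ZMod ((F.P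 K).sitesPerDir 0)))) e1 + (t : ZMod ((F.P K).sitesPerDir 0))), e0, e1, h01⟩) + GaugeGroup.dist1 (GaugeField.plaqHol U ⟨Function.update (Function.update (Function.update base e0 (base e0 + (((b.src e0 - base e0).val : ℕ) : ZMod ((F.P K).sitesPerDir 0)))) e1 ((Function.update base e0 (base e0 + (((b.src e0 - base e0).val : ℕ) : ZMod ((F.P K).sitesPerDir 0)))) e1 + (((b.src e1 - base e1).val : ℕ) : ZMod ((F.P K).sitesPerDir 0)))) e2 ((Function.update (Function.update base e0 (base e0 + (((b.src e0 - base e0).val : ℕ) : ZMod ((F.P K).sitesPerDir 0)))) e1 ((Function.update base e0 (base e0 + (((b.src e0 - base e0).val : ℕ) : ZMod ((F.P K).sitesPerDir 0)))) e1 + (((b.src e1 - base e1).val : ℕ) : ZMod ((F.P K).sitesPerDir 0)))) e2 + (t : ZMod ((F.P K).sitesPerDir 0))), e1, e2, h12⟩)) with hR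
  set box : PBond (F.P K) 0 → Prop := fun b => (∀ k, (b.src k - ((((a.src k).val * F.L ^ 1 : ℕ)) : ZMod ((F.P K).sitesPerDir 0)) + ((8 * F.L ^ 1 : ℕ) : ZMod ((F.P K).sitesPerDir 0))).val < 17 * F.L ^ 1) ∧ (∀ k, (b.tgt k - ((((a.src k).val * F.L ^ 1 : ℕ)) : ZMod ((F.P K).sitesPerDir 0)) + ((8 * F.L ^ 1 : ℕ) : ZMod ((F.P K).sitesPerDir 0))).val < 17 * F.L ^ 1) with hbox
  set f : GaugeField (F.P K) 0 (Matrix.specialUnitaryGroup (Fin 2) ℂ) → ℝ := fun U => GaugeGroup.dist1 (GaugeField.plaqHol (Averaging.iter (fun i' => BlockAveraging.blockAvg (P := F.P K) (j := i') ℰp) 1 U) a) with hf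
  set Gset : Set (GaugeField (F.P K) 0 (Matrix.specialUnitaryGroup (Fin 2) ℂ)) := {U : GaugeField (F.P K) 0 (Matrix.specialUnitaryGroup (Fin 2) ℂ) | (∀ (i : ℕ) (q : Plaq (F.P K) i), i < 1 → Site.tdist (fun k => ((((q.src k).val * F.L ^ i : ℕ)) : ZMod ((F.P K).sitesPerDir 0))) (fun k => ((((a.src k).val * F.L ^ 1 : ℕ)) : ZMod ((F.P K).sitesPerDir 0))) + 64 * F.L ^ i ≤ 64 * F.L ^ 1 → GaugeGroup.dist1 (GaugeField.plaqHol (Averaging.iter (fun i' => BlockAveraging.blockAvg (P := F.P K) (j := i') ℰp) i U) q) < θBal F.L γ b₀ p₀ (K - i))} with hGset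
  set Φ : GaugeField (F.P K) 0 (Matrix.specialUnitaryGroup (Fin 2) ℂ) → ℝ := fun U =>
    CL / Real.sqrt ((F.L : ℝ) ^ 1) * ∑ b : PBond (F.P K) 0, (if box b then R b U else 0) with hΦ
  -- §1 the window contains `1` and is gauge invariant; `f` vanishes at `1` and is gauge invariant
  have hone : (1 : GaugeField (F.P K) 0 (Matrix.specialUnitaryGroup (Fin 2) ℂ)) ∈ Gset := by
    simp only [hGset, Set.mem_setOf_eq]
    intro i q _ _
    rw [iter_blockAvg_one, hp1, GaugeGroup.dist1_one]
    exact θBal_pos hL1 hγ hγ1 hb₀ p₀ _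
  have hGinv : ∀ (u : GaugeTransf (F.P K) 0 (Matrix.specialUnitaryGroup (Fin 2) ℂ)) (U), U ∈ Gset → GaugeField.gaugeAct u U ∈ Gset := by
    intro u U hU
    simp only [hGset, Set.mem_setOf_eq] at hU ⊢
    intro i q hi hnear
    rw [dist1_plaqHol_iter_gaugeAct F (by omega) q u U]
    exact hU i q hi hnear
  have hf1 : f 1 = 0 := by
    simp only [hf]; rw [iter_blockAvg_one, hp1, GaugeGroup.dist1_one]
  have hfinv : ∀ u U, f (GaugeField.gaugeAct u U) = f U := fun u U => by
    simp only [hf]; exact dist1_plaqHol_iter_gaugeAct F (by omega) a u U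
  -- §2 pointwise: on the window, `f ≤ Φ`
  have hR0 : ∀ b U, 0 ≤ R b U := fun b U => Finset.sum_nonneg fun t _ =>
    add_nonneg (add_nonneg (GaugeGroup.dist1_nonneg _) (GaugeGroup.dist1_nonneg _)) (GaugeGroup.dist1_nonneg _)
  have hΦ0 : ∀ U, 0 ≤ Φ U := fun U => mul_nonneg (div_nonneg hCL (Real.sqrt_nonneg _))
    (Finset.sum_nonneg fun b _ => by split_ifs; exacts [hR0 b U, le_rfl])
  have hptw : ∀ U ∈ Gset, f U ≤ Φ U := by
    intro U hU
    set U' := GaugeField.gaugeAct (gsel U) U with hU'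
    have hU'G : U' ∈ Gset := hGinv _ U hU
    have hLip := hK2 U' 1 (by simpa only [hGset, Set.mem_setOf_eq] using hU'G) (by simpa only [hGset, Set.mem_setOf_eq] using hone)
    have hfU : f U = f U' := (hfinv (gsel U) U).symm
    have hXle : f U ≤ CL / Real.sqrt ((F.L : ℝ) ^ 1) * Real.sqrt (∑ b : PBond (F.P K) 0, if (∀ k, (b.src k - ((((a.src k).val * F.L ^ 1 : ℕ)) : ZMod ((F.P K).sitesPerDir 0)) + ((8 * F.L ^ 1 : ℕ) : ZMod ((F.P K).sitesPerDir 0))).val < 17 * F.L ^ 1) ∧ (∀ k, (b.tgt k - ((((a.src k).val * F.L ^ 1 : ℕ)) : ZMod ((F.P K).sitesPerDir 0)) + ((8 * F.L ^ 1 : ℕ) : ZMod ((F.P K).sitesPerDir 0))).val < 17 * F.L ^ 1) then GaugeGroup.dist1 (U' b * ((1 : GaugeField (F.P K) 0 (Matrix.specialUnitaryGroup (Fin 2) ℂ)) b)⁻¹) ^ 2 else 0) := by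
      have h := (le_abs_self _).trans hLip
      have hX1 : GaugeGroup.dist1 (GaugeField.plaqHol (Averaging.iter (fun i' => BlockAveraging.blockAvg (P := F.P K) (j := i') ℰp) 1
          (1 : GaugeField (F.P K) 0 (Matrix.specialUnitaryGroup (Fin 2) ℂ))) a) = 0 := hf1
      rw [hX1, sub_zero] at h
      rw [hfU]; exact h
    refine hXle.trans (mul_le_mul_of_nonneg_left ?_ (div_nonneg hCL (Real.sqrt_nonneg _)))
    -- `ℓ² ≤ ℓ¹`, then the comb bound bond by bond
    have hone_b : ∀ b : PBond (F.P K) 0, (1 : GaugeField (F.P K) 0 (Matrix.specialUnitaryGroup (Fin 2) ℂ)) b = 1 := fun b => rfl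
    have hsq : ∀ b : PBond (F.P K) 0, (if box b then GaugeGroup.dist1 (U' b * ((1 : GaugeField (F.P K) 0 (Matrix.specialUnitaryGroup (Fin 2) ℂ)) b)⁻¹) ^ 2 else 0) =
        (if box b then GaugeGroup.dist1 (U' b) else 0) ^ 2 := by
      intro b; rw [hone_b, inv_one, mul_one]; split_ifs <;> simp
    calc Real.sqrt (∑ b : PBond (F.P K) 0, if (∀ k, (b.src k - ((((a.src k).val * F.L ^ 1 : ℕ)) : ZMod ((F.P K).sitesPerDir 0)) + ((8 * F.L ^ 1 : ℕ) : ZMod ((F.P K).sitesPerDir 0))).val < 17 * F.L ^ 1) ∧ (∀ k, (b.tgt k - ((((a.src k).val * F.L ^ 1 : ℕ)) : ZMod ((F.P K).sitesPerDir 0)) + ((8 * F.L ^ 1 : ℕ) : ZMod ((F.P K).sitesPerDir 0))).val < 17 * F.L ^ 1) then GaugeGroup.dist1 (U' b * ((1 : GaugeField (F.P K) 0 (Matrix.specialUnitaryGroup (Fin 2) ℂ)) b)⁻¹) ^ 2 else 0)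
        = Real.sqrt (∑ b : PBond (F.P K) 0, (if box b then GaugeGroup.dist1 (U' b) else 0) ^ 2) := by
          congr 1; exact Finset.sum_congr rfl fun b _ => hsq b
      _ ≤ ∑ b : PBond (F.P K) 0, (if box b then GaugeGroup.dist1 (U' b) else 0) :=
          sqrt_sum_sq_le_sum _ _ fun b => by split_ifs; exacts [GaugeGroup.dist1_nonneg _, le_rfl]
      _ ≤ ∑ b : PBond (F.P K) 0, (if box b then R b U else 0) := by
          refine Finset.sum_le_sum fun b _ => ?_
          by_cases hb : box b
          · rw [if_pos hb, if_pos hb]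
            have hx : ∀ k, (b.src k - base k).val < n := fun k => by rw [← hbk]; exact hb.1 k
            have hxμ : ((b.src.shift b.dir) b.dir - base b.dir).val < n := by rw [← hbk]; exact hb.2 b.dir
            have h := hgsel U b.src b.dir hx hxμ
            exact h
          · rw [if_neg hb, if_neg hb]
  have hind : ∀ U, Gset.indicator f U ≤ Φ U := by
    intro U
    by_cases hU : U ∈ Gset
    · rw [Set.indicator_of_mem hU]; exact hptw U hU
    · rw [Set.indicator_of_notMem hU]; exact hΦ0 U
  -- §3 integrate: the ladder sums have mean `≤ 3n·C₁·g_K`, there are `≤ 3n³` box bonds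
  have hdm : ∀ p : Plaq (F.P K) 0, Measurable fun U : GaugeField (F.P K) 0 (Matrix.specialUnitaryGroup (Fin 2) ℂ) =>
      GaugeGroup.dist1 (GaugeField.plaqHol U p) :=
    fun p => RegularGaugeGroup.measurable_dist1.comp (Missing.measurable_plaqHol p)
  have hdi : ∀ p : Plaq (F.P K) 0, Integrable (fun U : GaugeField (F.P K) 0 (Matrix.specialUnitaryGroup (Fin 2) ℂ) =>
      GaugeGroup.dist1 (GaugeField.plaqHol U p)) μ := fun p =>
    Integrable.mono' (integrable_const (2 : ℝ)) (hdm p).aestronglyMeasurable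
      (ae_of_all _ fun U => by
        rw [Real.norm_eq_abs, abs_of_nonneg (GaugeGroup.dist1_nonneg _)]
        exact T4PairDerivBridge.dist1_le_two_specialUnitaryGroup _)
  have hRi : ∀ b, Integrable (R b) μ := by
    intro b
    simp only [hR]
    refine integrable_finsetSum _ fun t _ => ?_
    exact ((hdi _).add (hdi _)).add (hdi _)
  have hRint : ∀ b, ∫ U, R b U ∂μ ≤ (n : ℝ) * (3 * (C₁ * gK)) := by
    intro b
    -- termwise integrability, in eta form
    have hti : ∀ (p₁ p₂ p₃ : Plaq (F.P K) 0), Integrable (fun U : GaugeField (F.P K) 0 (Matrix.specialUnitaryGroup (Fin 2) ℂ) =>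
        GaugeGroup.dist1 (GaugeField.plaqHol U p₁) + GaugeGroup.dist1 (GaugeField.plaqHol U p₂) +
          GaugeGroup.dist1 (GaugeField.plaqHol U p₃)) μ := fun p₁ p₂ p₃ => ((hdi p₁).add (hdi p₂)).add (hdi p₃)
    have htint : ∀ (p₁ p₂ p₃ : Plaq (F.P K) 0), ∫ U, (GaugeGroup.dist1 (GaugeField.plaqHol U p₁) +
        GaugeGroup.dist1 (GaugeField.plaqHol U p₂) + GaugeGroup.dist1 (GaugeField.plaqHol U p₃)) ∂μ ≤ 3 * (C₁ * gK) := by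
      intro p₁ p₂ p₃
      have h12i : Integrable (fun U : GaugeField (F.P K) 0 (Matrix.specialUnitaryGroup (Fin 2) ℂ) =>
          GaugeGroup.dist1 (GaugeField.plaqHol U p₁) + GaugeGroup.dist1 (GaugeField.plaqHol U p₂)) μ := (hdi p₁).add (hdi p₂)
      rw [integral_add h12i (hdi p₃), integral_add (hdi p₁) (hdi p₂)]
      linarith [hE1 p₁, hE1 p₂, hE1 p₃]
    simp only [hR]
    rw [integral_finsetSum _ (fun t _ => hti _ _ _)]
    calc _ ≤ ∑ t ∈ Finset.range (17 * F.L ^ 1), 3 * (C₁ * gK) := Finset.sum_le_sum fun t _ => htint _ _ _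
      _ = (n : ℝ) * (3 * (C₁ * gK)) := by rw [Finset.sum_const, Finset.card_range, nsmul_eq_mul, hn]
  have hΦi : Integrable Φ μ := by
    simp only [hΦ]
    refine Integrable.const_mul (integrable_finsetSum _ fun b _ => ?_) _
    by_cases hb : box b
    · simp only [if_pos hb]; exact hRi b
    · simp only [if_neg hb]; exact integrable_const _
  have hcard : ((Finset.univ.filter box).card : ℝ) ≤ 3 * (n : ℝ) ^ 3 := by
    have hsub : Finset.univ.filter box ⊆ Finset.univ.filter (fun b : PBond (F.P K) 0 => ∀ k, (b.src k - base k).val < n) := by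
      intro b hb
      simp only [Finset.mem_filter, Finset.mem_univ, true_and, hbox] at hb ⊢
      intro k; rw [← hbk]; exact hb.1 k
    calc ((Finset.univ.filter box).card : ℝ) ≤ ((Finset.univ.filter (fun b : PBond (F.P K) 0 => ∀ k, (b.src k - base k).val < n)).card : ℝ) := by
          exact_mod_cast Finset.card_le_card hsub
      _ ≤ 3 * (n : ℝ) ^ 3 := card_filter_offsets_lt_le F K base n
  have hΦint : ∫ U, Φ U ∂μ ≤ CL / Real.sqrt ((F.L : ℝ) ^ 1) * ((3 * (n : ℝ) ^ 3) * ((n : ℝ) * (3 * (C₁ * gK)))) := by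
    simp only [hΦ]
    rw [integral_const_mul]
    refine mul_le_mul_of_nonneg_left ?_ (div_nonneg hCL (Real.sqrt_nonneg _))
    rw [integral_finsetSum _ (fun b _ => ?_)]
    · calc ∑ b : PBond (F.P K) 0, ∫ U, (if box b then R b U else 0) ∂μ
          ≤ ∑ b : PBond (F.P K) 0, (if box b then (n : ℝ) * (3 * (C₁ * gK)) else 0) := by
            refine Finset.sum_le_sum fun b _ => ?_
            by_cases hb : box b
            · simp only [if_pos hb]; exact hRint b
            · simp only [if_neg hb, integral_zero]; exact le_rfl
        _ = ((Finset.univ.filter box).card : ℝ) * ((n : ℝ) * (3 * (C₁ * gK))) := by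
            rw [Finset.sum_ite, Finset.sum_const_zero, add_zero, Finset.sum_const, nsmul_eq_mul]
        _ ≤ (3 * (n : ℝ) ^ 3) * ((n : ℝ) * (3 * (C₁ * gK))) :=
            mul_le_mul_of_nonneg_right hcard (by positivity)
    · by_cases hb : box b
      · simp only [if_pos hb]; exact hRi b
      · simp only [if_neg hb]; exact integrable_const _
  -- §4 the restricted mean and Markov on the window
  have hGmeas : MeasurableSet Gset := by
    simp only [hGset]
    exact Summit.QuantumFields.YangMills.Theorems.LocalInsertion.HistoryTailOfInsertion.measurableSet_localGood F
      (fun i => θBal F.L γ b₀ p₀ (K - i)) K 1 _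
  have hfm : Measurable f := Summit.QuantumFields.YangMills.Theorems.LocalInsertion.HistoryTailOfInsertion.measurable_flux F K 1 a
  have hfi : Integrable f μ := Integrable.mono' (integrable_const (2 : ℝ)) hfm.aestronglyMeasurable
    (ae_of_all _ fun U => by
      rw [Real.norm_eq_abs, abs_of_nonneg (GaugeGroup.dist1_nonneg _)]
      exact T4PairDerivBridge.dist1_le_two_specialUnitaryGroup _)
  have hindi : Integrable (Gset.indicator f) μ := hfi.indicator hGmeas
  have hind0 : 0 ≤ᵐ[μ] Gset.indicator f := ae_of_all _ fun U =>
    Set.indicator_nonneg (fun _ _ => GaugeGroup.dist1_nonneg _) U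
  have hmean : ∫ U, Gset.indicator f U ∂μ ≤ CL / Real.sqrt ((F.L : ℝ) ^ 1) * ((3 * (n : ℝ) ^ 3) * ((n : ℝ) * (3 * (C₁ * gK)))) :=
    (integral_mono hindi hΦi hind).trans hΦint
  exact hmean

/-- **THE HEIGHT-ONE MEDIAN ROW FROM THE MEAN PLAQUETTE DEVIATION AT SCALE `g_K`.**  One instance `(F, γ ≤ 1, K ≥ 3)`, one height-one
plaquette `a`.  ASSUME the window-Lipschitz row `hK2` at `(a, j = 1)` (the text of ✓`stub_levelOneLipschitz`, constant `CL`), the FIRST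
MOMENT OF THE BARE PLAQUETTE DEVIATION AT THE GAUSSIAN SCALE `hE1 : ∫ dist1 U(∂p) ∂Gibbs_K ≤ C₁·g_K` for every level-0 plaquette
(`g_K = √(γL^{−K})` — the equipartition-type input, NOT in the tree uniformly in `β`), and local goodness `Gibbs_K(G(a,1)ᶜ) ≤ ¼`.  THEN the
median row of ✓`WindowTailOfConcentration.windowTail_step` holds at `(a, 1)`: `½ ≤ Gibbs_K(G(a,1) ∩ {dist1(Ū¹(∂a)) ≤ m·g_{K−1}})` with the
K- and γ-UNIFORM `m = 36·(CL+1)·(C₁+1)·(17L)⁴/L`.  Proof: comb gauge (✓`exists_combGauge_dist1_le`): on `G`,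
`dist1(Ū¹(∂a))(U) = dist1(Ū¹(∂a))(U^g) ≤ (CL/√L)·d_box(U^g, 1) ≤ (CL/√L)·Σ_{box bonds} dist1((U^g)_b) ≤ (CL/√L)·Σ_{box bonds} (ladder sums)`;
expectation `≤ (CL/√L)·3(17L)³·3·17L·C₁·g_K`, `g_K = g_{K−1}/√L`; Markov on `G`. [cite: Balaban1985UV3, (3) p.256 and (7) p.257] -/
theorem median_heightOne_of_meanPlaquette (F : T3Family) {γ b₀ p₀ CL C₁ : ℝ} (hγ : 0 < γ) (hγ1 : γ ≤ 1) (hb₀ : 0 < b₀)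
    {K : ℕ} (hK : 3 ≤ K) (a : Plaq (F.P K) 1) (hCL : 0 ≤ CL) (hC₁ : 0 ≤ C₁)
    (hK2 : ∀ U U' : GaugeField (F.P K) 0 (Matrix.specialUnitaryGroup (Fin 2) ℂ), (∀ (i : ℕ) (q : Plaq (F.P K) i), i < 1 → Site.tdist (fun k => ((((q.src k).val * F.L ^ i : ℕ)) : ZMod ((F.P K).sitesPerDir 0))) (fun k => ((((a.src k).val * F.L ^ 1 : ℕ)) : ZMod ((F.P K).sitesPerDir 0))) + 64 * F.L ^ i ≤ 64 * F.L ^ 1 → GaugeGroup.dist1 (GaugeField.plaqHol (Averaging.iter (fun i' => BlockAveraging.blockAvg (P := F.P K) (j := i') ℰp) i U) q) < θBal F.L γ b₀ p₀ (K - i)) → (∀ (i : ℕ) (q : Plaq (F.P K) i), i < 1 → Site.tdist (fun k => ((((q.src k).val * F.L ^ i : ℕ)) : ZMod ((F.P K).sitesPerDir 0))) (fun k => ((((a.src k).val * F.L ^ 1 : ℕ)) : ZMod ((F.P K).sitesPerDir 0))) + 64 * F.L ^ i ≤ 64 * F.L ^ 1 → GaugeGroup.dist1 (GaugeField.plaqHol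 (Averaging.iter (fun i' => BlockAveraging.blockAvg (P := F.P K) (j := i') ℰp) i U') q) < θBal F.L γ b₀ p₀ (K - i)) →
      |GaugeGroup.dist1 (GaugeField.plaqHol (Averaging.iter (fun i' => BlockAveraging.blockAvg (P := F.P K) (j := i') ℰp) 1 U) a) - GaugeGroup.dist1 (GaugeField.plaqHol (Averaging.iter (fun i' => BlockAveraging.blockAvg (P := F.P K) (j := i') ℰp) 1 U') a)| ≤ CL / Real.sqrt ((F.L : ℝ) ^ 1) * Real.sqrt (∑ b : PBond (F.P K) 0, if (∀ k, (b.src k - ((((a.src k).val * F.L ^ 1 : ℕ)) : ZMod ((F.P K).sitesPerDir 0)) + ((8 * F.L ^ 1 : ℕ) : ZMod ((F.P K).sitesPerDir 0))).val < 17 * F.L ^ 1) ∧ (∀ k, (b.tgt k - ((((a.src k).val * F.L ^ 1 : ℕ)) : ZMod ((F.P K).sitesPerDir 0)) + ((8 * F.L ^ 1 : ℕ) : ZMod ((F.P K).sitesPerDir 0))).val < 17 * F.L ^ 1) then GaugeGroup.dist1 (U b * (U' b)⁻¹) ^ 2 else 0))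
    (hE1 : ∀ p : Plaq (F.P K) 0, ∫ U, GaugeGroup.dist1 (GaugeField.plaqHol U p) ∂(gibbsK F ℰp γ K) ≤ C₁ * Real.sqrt (γ * ((F.L : ℝ)⁻¹) ^ K))
    (hGc : (gibbsK F ℰp γ K).real {U : GaugeField (F.P K) 0 (Matrix.specialUnitaryGroup (Fin 2) ℂ) | (∀ (i : ℕ) (q : Plaq (F.P K) i), i < 1 → Site.tdist (fun k => ((((q.src k).val * F.L ^ i : ℕ)) : ZMod ((F.P K).sitesPerDir 0))) (fun k => ((((a.src k).val * F.L ^ 1 : ℕ)) : ZMod ((F.P K).sitesPerDir 0))) + 64 * F.L ^ i ≤ 64 * F.L ^ 1 → GaugeGroup.dist1 (GaugeField.plaqHol (Averaging.iter (fun i' => BlockAveraging.blockAvg (P := F.P K) (j := i') ℰp) i U) q) < θBal F.L γ b₀ p₀ (K - i))}ᶜ ≤ 1 / 4) :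
    1 / 2 ≤ (gibbsK F ℰp γ K).real ({U : GaugeField (F.P K) 0 (Matrix.specialUnitaryGroup (Fin 2) ℂ) | (∀ (i : ℕ) (q : Plaq (F.P K) i), i < 1 → Site.tdist (fun k => ((((q.src k).val * F.L ^ i : ℕ)) : ZMod ((F.P K).sitesPerDir 0))) (fun k => ((((a.src k).val * F.L ^ 1 : ℕ)) : ZMod ((F.P K).sitesPerDir 0))) + 64 * F.L ^ i ≤ 64 * F.L ^ 1 → GaugeGroup.dist1 (GaugeField.plaqHol (Averaging.iter (fun i' => BlockAveraging.blockAvg (P := F.P K) (j := i') ℰp) i U) q) < θBal F.L γ b₀ p₀ (K - i))} ∩ {U | GaugeGroup.dist1 (GaugeField.plaqHol (Averaging.iter (fun i' => BlockAveraging.blockAvg (P := F.P K) (j := i') ℰp) 1 U) a) ≤ (36 * (CL + 1) * (C₁ + 1) * (17 * (F.L : ℝ)) ^ 4 / F.L) * Real.sqrt (γ * ((F.L : ℝ)⁻¹) ^ (K - 1))}) := by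
  classical
  haveI := isProbabilityMeasure_gibbsK F ℰp hγ.le K
  have hL1 : 1 ≤ F.L := F.hL.2.le
  have hL0 : (0 : ℝ) < F.L := by exact_mod_cast lt_of_lt_of_le zero_lt_one hL1
  set μ := gibbsK F ℰp γ K with hμ
  set gK : ℝ := Real.sqrt (γ * ((F.L : ℝ)⁻¹) ^ K) with hgK
  set g1 : ℝ := Real.sqrt (γ * ((F.L : ℝ)⁻¹) ^ (K - 1)) with hg1
  have hg1pos : 0 < g1 := Real.sqrt_pos.2 (mul_pos hγ (pow_pos (inv_pos.2 hL0) _))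
  have hgK1 : gK = g1 / Real.sqrt (F.L : ℝ) := by
    rw [hgK, hg1, eq_div_iff (Real.sqrt_pos.2 hL0).ne', ← Real.sqrt_mul (by positivity)]
    congr 1
    have hK1 : K = (K - 1) + 1 := by omega
    conv_lhs => rw [hK1]
    rw [pow_succ]; field_simp
  set n : ℕ := 17 * F.L ^ 1 with hn
  set f : GaugeField (F.P K) 0 (Matrix.specialUnitaryGroup (Fin 2) ℂ) → ℝ := fun U => GaugeGroup.dist1 (GaugeField.plaqHol (Averaging.iter (fun i' => BlockAveraging.blockAvg (P := F.P K) (j := i') ℰp) 1 U) a) with hf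
  set Gset : Set (GaugeField (F.P K) 0 (Matrix.specialUnitaryGroup (Fin 2) ℂ)) := {U : GaugeField (F.P K) 0 (Matrix.specialUnitaryGroup (Fin 2) ℂ) | (∀ (i : ℕ) (q : Plaq (F.P K) i), i < 1 → Site.tdist (fun k => ((((q.src k).val * F.L ^ i : ℕ)) : ZMod ((F.P K).sitesPerDir 0))) (fun k => ((((a.src k).val * F.L ^ 1 : ℕ)) : ZMod ((F.P K).sitesPerDir 0))) + 64 * F.L ^ i ≤ 64 * F.L ^ 1 → GaugeGroup.dist1 (GaugeField.plaqHol (Averaging.iter (fun i' => BlockAveraging.blockAvg (P := F.P K) (j := i') ℰp) i U) q) < θBal F.L γ b₀ p₀ (K - i))} with hGset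
  have hmean : ∫ U, Gset.indicator f U ∂μ ≤ CL / Real.sqrt ((F.L : ℝ) ^ 1) * ((3 * (n : ℝ) ^ 3) * ((n : ℝ) * (3 * (C₁ * gK)))) :=
    integral_indicator_heightOne_le F hγ hγ1 hb₀ hK a hCL hC₁ hK2 hE1
  have hGmeas : MeasurableSet Gset := by
    simp only [hGset]
    exact Summit.QuantumFields.YangMills.Theorems.LocalInsertion.HistoryTailOfInsertion.measurableSet_localGood F
      (fun i => θBal F.L γ b₀ p₀ (K - i)) K 1 _
  have hfm : Measurable f := Summit.QuantumFields.YangMills.Theorems.LocalInsertion.HistoryTailOfInsertion.measurable_flux F K 1 a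
  have hfi : Integrable f μ := Integrable.mono' (integrable_const (2 : ℝ)) hfm.aestronglyMeasurable
    (ae_of_all _ fun U => by
      rw [Real.norm_eq_abs, abs_of_nonneg (GaugeGroup.dist1_nonneg _)]
      exact T4PairDerivBridge.dist1_le_two_specialUnitaryGroup _)
  have hindi : Integrable (Gset.indicator f) μ := hfi.indicator hGmeas
  have hind0 : 0 ≤ᵐ[μ] Gset.indicator f := ae_of_all _ fun U =>
    Set.indicator_nonneg (fun _ _ => GaugeGroup.dist1_nonneg _) U
  -- the level
  set m : ℝ := 36 * (CL + 1) * (C₁ + 1) * (17 * (F.L : ℝ)) ^ 4 / F.L with hm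
  have hmg : 0 < m * g1 := by positivity
  have hMarkov := mul_meas_ge_le_integral_of_nonneg hind0 hindi (m * g1)
  have hsubset : Gset ∩ {U | m * g1 ≤ f U} ⊆ {U | m * g1 ≤ Gset.indicator f U} := by
    rintro U ⟨hU, hU'⟩
    simp only [Set.mem_setOf_eq] at hU' ⊢
    rw [Set.indicator_of_mem hU]; exact hU'
  -- the key numerical inequality: `mean ≤ (m g1)/4`
  have hnum : CL / Real.sqrt ((F.L : ℝ) ^ 1) * ((3 * (n : ℝ) ^ 3) * ((n : ℝ) * (3 * (C₁ * gK)))) ≤ m * g1 / 4 := by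
    have hnr : (n : ℝ) = 17 * (F.L : ℝ) := by rw [hn]; push_cast; ring
    have hsL2 : Real.sqrt (F.L : ℝ) * Real.sqrt (F.L : ℝ) = F.L := Real.mul_self_sqrt hL0.le
    have e1 : CL / Real.sqrt ((F.L : ℝ) ^ 1) * ((3 * (n : ℝ) ^ 3) * ((n : ℝ) * (3 * (C₁ * gK)))) =
        9 * (CL * C₁) * ((17 * (F.L : ℝ)) ^ 4 * g1 * (1 / (Real.sqrt (F.L : ℝ) * Real.sqrt (F.L : ℝ)))) := by
      rw [pow_one, hgK1, hnr]; ring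
    have e2 : m * g1 / 4 = 9 * ((CL + 1) * (C₁ + 1)) * ((17 * (F.L : ℝ)) ^ 4 * g1 * (1 / (F.L : ℝ))) := by
      rw [hm]; ring
    rw [e1, hsL2, e2]
    have hX : 0 ≤ (17 * (F.L : ℝ)) ^ 4 * g1 * (1 / (F.L : ℝ)) := by positivity
    have hc : 9 * (CL * C₁) ≤ 9 * ((CL + 1) * (C₁ + 1)) := by nlinarith [mul_nonneg hCL hC₁]
    exact mul_le_mul_of_nonneg_right hc hX
  have hup : μ.real (Gset ∩ {U | m * g1 ≤ f U}) ≤ 1 / 4 := by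
    have h1 : μ.real (Gset ∩ {U | m * g1 ≤ f U}) ≤ μ.real {U | m * g1 ≤ Gset.indicator f U} :=
      measureReal_mono hsubset (measure_ne_top _ _)
    have h2 : (m * g1) * μ.real {U | m * g1 ≤ Gset.indicator f U} ≤ m * g1 / 4 :=
      hMarkov.trans (hmean.trans hnum)
    have h3 : μ.real {U | m * g1 ≤ Gset.indicator f U} ≤ 1 / 4 := by
      have h2' : m * g1 * μ.real {U | m * g1 ≤ Gset.indicator f U} ≤ m * g1 * (1 / 4) := by
        have : m * g1 / 4 = m * g1 * (1 / 4) := by ring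
        rw [← this]; exact h2
      exact le_of_mul_le_mul_left h2' hmg
    exact h1.trans h3
  -- §5 conclude
  have hcover : Gset ⊆ (Gset ∩ {U | f U ≤ m * g1}) ∪ (Gset ∩ {U | m * g1 ≤ f U}) := by
    intro U hU
    by_cases h : f U ≤ m * g1
    · exact Or.inl ⟨hU, h⟩
    · exact Or.inr ⟨hU, (not_le.mp h).le⟩
  have hGge : 3 / 4 ≤ μ.real Gset := by
    have h1 : μ.real Gset + μ.real Gsetᶜ = 1 := probReal_add_probReal_compl hGmeas
    have h2 : μ.real Gsetᶜ ≤ 1 / 4 := hGc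
    linarith
  have hsplit : μ.real Gset ≤ μ.real (Gset ∩ {U | f U ≤ m * g1}) + μ.real (Gset ∩ {U | m * g1 ≤ f U}) :=
    (measureReal_mono hcover (measure_ne_top _ _)).trans (measureReal_union_le _ _)
  show 1 / 2 ≤ μ.real (Gset ∩ {U | f U ≤ m * g1})
  linarith

end Summit.QuantumFields.YangMills.Theorems.LocalInsertion.MedianHeightOne
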